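import Summits.ResolutionOfSingularities.ResolutionOfSingularities.Theorems.EquisingularLiftEquisingularLiftNatSpecimenCayleyRuledAlgebra
import Summits.ResolutionOfSingularities.ResolutionOfSingularities.Theorems.EquisingularLiftEquisingularLiftNatNoseTowerBTriplePrimeDoubleLine
import Summits.ResolutionOfSingularities.ResolutionOfSingularities.Theorems.EquisingularLiftEquisingularLiftNatDoubleLineBlowupCharts
import Summits.ResolutionOfSingularities.ResolutionOfSingularities.Theorems.EquisingularLiftEquisingularLiftNatSpecimenWhitneyCubicForms
import HarnessLib

/-!
# [OURS · L1 W4.5(b) · EL♮(3)] NOSE ENGINE CERTIFICATION ‖ K, specimen 3 — CAYLEY'S RULED CUBIC `x₀x₂² + x₁x₂x₃ + x₃³`: `ReachNoseTowerBTriplePrime` and EL♮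
# THROUGH THE GENERIC DOUBLE-LINE FILES (first end-to-end use of p645692 + p645742: the specimen supplies polynomial algebra only)

Cell `res-hironaka`, slot W4.5(b); crux **EL♮(3)** (stmt-ResolutionOfSingularities-20148; parent EL♮ stmt-…-20038); width seat res-L1-w45b-nose-w3, row
«NOSE ENGINE CERT ‖ K» of res-L1-w45b-plan-1's WIDTH TABLE D1′. `--supports stmt-ResolutionOfSingularities-20148 --as helper`; closes nothing. OURS; NOT a
statement of any manuscript; AI-written, weaker than expert review. One `def` (the form), no `sorry`, standard axioms.

The specimen `H = V₊(F)`, `F = x₀x₂² + x₁x₂x₃ + x₃³` — CAYLEY'S RULED CUBIC: singular along the double line `Σ = V(x₂, x₃)`, transversal type `A₁` off the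
cusp-pinch `[1:0:0:0]`; the second projective type of cubic scroll with a double line (R2's Whitney-type cubic, two pinch points, is the first). Inputs:
`…NatSpecimenCayleyRuledAlgebra` (the four strict-transform charts, the two smooth charts, primes/radicals) and the generic double-line files
`DoubleLine.isRegular_of_isBlowup_comap_vanishingIdeal` (p645742) / `DoubleLine.reachNoseTowerBTriplePrime_of_isRegular_blowups`,
`DoubleLine.elNatAt_of_isRegular_blowups` (p645692).

* `form`, `isHomogeneous_form`, `prime_form` (degree one in `x₀`, coefficient `x₂²` vs `x₁x₂x₃ + x₃³`), `form_mem_span` (`F ∈ (x₂, x₃)`),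
  `X_two_not_mem_span_form`, `dehomogenize_form_*` (`= g₀ … g₃`), `isRegularRing_chartRing_of_two_le`;
* `isRegular_blowups` — every blow-up of `H` along `𝓘⟨Σ⟩ · 𝒪_H` is regular (generic charts, ONE line);
* ★ **`reachNoseTowerBTriplePrime_cayleyRuled`** — `ReachNoseTowerBTriplePrime K 3 H ι` (any field): THIRD kernel inhabitant of the B‴ nose predicate;
* ★ **`elNatAt_cayleyRuled`** — `ELNatAt p K 3 H ι` for `K` algebraically closed of characteristic `p`, ANY `p`, through the landed rung p524326.
-/

set_option linter.dupNamespace false -- mandated namespace `Summit.<Summit>.<Problem>` of this single-conjunct summit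

noncomputable section

open CategoryTheory CategoryTheory.Limits AlgebraicGeometry TopologicalSpace
open MvPolynomial HomogeneousLocalization
open Literature.AlgebraicGeometry.Resolution
open Literature.AlgebraicGeometry.Motives Literature.AlgebraicGeometry.Motives.SmoothHypersurface
open Literature.AlgebraicGeometry.Motives.ProjectiveSpace
open AlgebraicGeometry.Scheme.IdealSheafData

namespace Summit.ResolutionOfSingularities.ResolutionOfSingularities.Cruxes.EquisingularLiftNat.Sections

namespace CayleyRuled

variable (k : Type) [Field k]

attribute [local instance] MvPolynomial.gradedAlgebra ProjBaseChange.algebraBase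

/-! ## The form `F = x₀x₂² + x₁x₂x₃ + x₃³` -/

/-- **Cayley's ruled cubic form** `F = x₀x₂² + x₁x₂x₃ + x₃³ ∈ k[x₀, x₁, x₂, x₃]` (double line `V(x₂, x₃)`, one cusp-pinch `[1:0:0:0]`). [folklore] -/
def form : MvPolynomial (Fin 4) k := X 0 * X 2 ^ 2 + X 1 * X 2 * X 3 + X 3 ^ 3

/-- `F` is homogeneous of degree `3`. [folklore] -/
theorem isHomogeneous_form : (CayleyRuled.form k).IsHomogeneous 3 := by
  have h1 : (X 0 * X 2 ^ 2 : MvPolynomial (Fin 4) k).IsHomogeneous 3 := by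
    simpa using (isHomogeneous_X k (0 : Fin 4)).mul ((isHomogeneous_X k (2 : Fin 4)).pow 2)
  have h2 : (X 1 * X 2 * X 3 : MvPolynomial (Fin 4) k).IsHomogeneous 3 := by
    simpa using ((isHomogeneous_X k (1 : Fin 4)).mul (isHomogeneous_X k (2 : Fin 4))).mul (isHomogeneous_X k (3 : Fin 4))
  have h3 : (X 3 ^ 3 : MvPolynomial (Fin 4) k).IsHomogeneous 3 := by
    simpa using (isHomogeneous_X k (3 : Fin 4)).pow 3
  exact (h1.add h2).add h3

/-- In `x₀`-adic form: `F = C(y₁²)·Y + C(y₀y₁y₂ + y₂³)` over `k[y₀, y₁, y₂]` (`y = (x₁, x₂, x₃)`). [folklore] -/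
theorem finSuccEquiv_form :
    finSuccEquiv k 3 (CayleyRuled.form k) = Polynomial.C (X 1 ^ 2) * Polynomial.X + Polynomial.C (X 0 * X 1 * X 2 + X 2 ^ 3) := by
  have h1 : finSuccEquiv k 3 (X 1) = Polynomial.C (X 0) := finSuccEquiv_X_succ (j := 0)
  have h2 : finSuccEquiv k 3 (X 2) = Polynomial.C (X 1) := finSuccEquiv_X_succ (j := 1)
  have h3 : finSuccEquiv k 3 (X 3) = Polynomial.C (X 2) := finSuccEquiv_X_succ (j := 2)
  simp only [CayleyRuled.form, map_add, map_mul, map_pow, finSuccEquiv_X_zero, h1, h2, h3]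
  ring

/-- The coefficients `y₁²` and `y₀y₁y₂ + y₂³` are relatively prime in `k[y₀, y₁, y₂]` (`y₁ ∤ y₂³`). [folklore] -/
theorem isRelPrime_coeff₃ : IsRelPrime (X 1 ^ 2 : MvPolynomial (Fin 3) k) (X 0 * X 1 * X 2 + X 2 ^ 3) := by
  have hp : Prime (X 1 : MvPolynomial (Fin 3) k) := X_prime
  have hnd : ¬ ((X 1 : MvPolynomial (Fin 3) k) ∣ X 0 * X 1 * X 2 + X 2 ^ 3) := by
    intro h
    have hdiv : (X 1 : MvPolynomial (Fin 3) k) ∣ X 0 * X 1 * X 2 :=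
      Dvd.dvd.mul_right (dvd_mul_left (X 1) (X 0)) (X 2)
    have h' : (X 1 : MvPolynomial (Fin 3) k) ∣ X 2 ^ 3 := (dvd_add_right hdiv).mp h
    exact absurd (X_dvd_X.mp (hp.dvd_of_dvd_pow h')) (by decide)
  exact (isRelPrime_of_prime_of_not_dvd hp hnd).pow_left

/-- **`F` is prime** (degree one in `x₀` with relatively prime coefficients; Mathlib `Polynomial.irreducible_C_mul_X_add_C`). [folklore] -/
theorem prime_form : Prime (CayleyRuled.form k) := by
  have hirr : Irreducible (CayleyRuled.form k) := by
    rw [← MulEquiv.irreducible_iff (finSuccEquiv k 3), finSuccEquiv_form]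
    exact Polynomial.irreducible_C_mul_X_add_C (pow_ne_zero 2 (X_ne_zero 1)) (isRelPrime_coeff₃ k)
  exact UniqueFactorizationMonoid.irreducible_iff_prime.mp hirr

/-- `F ∈ (x₂, x₃)`. [folklore] -/
theorem form_mem_span : CayleyRuled.form k ∈ Ideal.span {(X 2 : MvPolynomial (Fin 4) k), X 3} := by
  have h2 : (X 2 : MvPolynomial (Fin 4) k) ∈ Ideal.span {(X 2 : MvPolynomial (Fin 4) k), X 3} := Ideal.subset_span (by simp)
  have h3 : (X 3 : MvPolynomial (Fin 4) k) ∈ Ideal.span {(X 2 : MvPolynomial (Fin 4) k), X 3} := Ideal.subset_span (by simp)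
  rw [CayleyRuled.form]
  refine Ideal.add_mem _ (Ideal.add_mem _ ?_ ?_) ?_
  · exact Ideal.mul_mem_left _ _ (Ideal.pow_mem_of_mem _ h2 2 two_pos)
  · exact Ideal.mul_mem_left _ _ h3
  · exact Ideal.pow_mem_of_mem _ h3 3 three_pos

/-- `x₂ ∉ (F)`: evaluate at `(0, 0, 1, 0)` (`F ↦ 0`, `x₂ ↦ 1`). [folklore] -/
theorem X_two_not_mem_span_form : (X 2 : MvPolynomial (Fin 4) k) ∉ Ideal.span {CayleyRuled.form k} := by
  intro h
  obtain ⟨q, hq⟩ := Ideal.mem_span_singleton'.mp h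
  have h := congrArg (MvPolynomial.eval ![(0 : k), 0, 1, 0]) hq
  rw [CayleyRuled.form] at h
  simp at h

/-! ## The dehomogenized equations -/

/-- `F(x₀ := 1) = g₀ = y₁² + y₀y₁y₂ + y₂³` (`y = (x₁, x₂, x₃)`). [folklore] -/
theorem dehomogenize_form_zero : dehomogenize k (0 : Fin 4) (CayleyRuled.form k) = g₀ k := by
  simp only [CayleyRuled.form, g₀, map_add, map_mul, map_pow, dehomogenize_X_self,
    WhitneyCubic.dehomogenize_X_of_eq k 0 1 0 (by decide), WhitneyCubic.dehomogenize_X_of_eq k 0 2 1 (by decide),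
    WhitneyCubic.dehomogenize_X_of_eq k 0 3 2 (by decide), one_mul]

/-- `F(x₁ := 1) = g₁ = y₀y₁² + y₁y₂ + y₂³` (`y = (x₀, x₂, x₃)`). [folklore] -/
theorem dehomogenize_form_one : dehomogenize k (1 : Fin 4) (CayleyRuled.form k) = g₁ k := by
  simp only [CayleyRuled.form, g₁, map_add, map_mul, map_pow, dehomogenize_X_self,
    WhitneyCubic.dehomogenize_X_of_eq k 1 0 0 (by decide), WhitneyCubic.dehomogenize_X_of_eq k 1 2 1 (by decide),
    WhitneyCubic.dehomogenize_X_of_eq k 1 3 2 (by decide), one_mul]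

/-- `F(x₂ := 1) = g₂ = y₀ + y₁y₂ + y₂³` (`y = (x₀, x₁, x₃)`). [folklore] -/
theorem dehomogenize_form_two : dehomogenize k (2 : Fin 4) (CayleyRuled.form k) = g₂ k := by
  simp only [CayleyRuled.form, g₂, map_add, map_mul, map_pow, dehomogenize_X_self,
    WhitneyCubic.dehomogenize_X_of_eq k 2 0 0 (by decide), WhitneyCubic.dehomogenize_X_of_eq k 2 1 1 (by decide),
    WhitneyCubic.dehomogenize_X_of_eq k 2 3 2 (by decide), one_pow, mul_one]

/-- `F(x₃ := 1) = g₃ = y₀y₂² + y₁y₂ + 1` (`y = (x₀, x₁, x₂)`). [folklore] -/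
theorem dehomogenize_form_three : dehomogenize k (3 : Fin 4) (CayleyRuled.form k) = g₃ k := by
  simp only [CayleyRuled.form, g₃, map_add, map_mul, map_pow, dehomogenize_X_self,
    WhitneyCubic.dehomogenize_X_of_eq k 3 0 0 (by decide), WhitneyCubic.dehomogenize_X_of_eq k 3 1 1 (by decide),
    WhitneyCubic.dehomogenize_X_of_eq k 3 2 2 (by decide), one_pow, mul_one]

/-- All four dehomogenisations span radical ideals (the locally-principal binder). [folklore] -/
theorem radical_dehomogenize (c : Fin (2 + 2)) :
    (Ideal.span {dehomogenize k c (CayleyRuled.form k)}).radical = Ideal.span {dehomogenize k c (CayleyRuled.form k)} := by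
  fin_cases c
  · exact (congrArg (fun q => (Ideal.span {q}).radical) (dehomogenize_form_zero k)).trans
      ((radical_span_g₀ k).trans (congrArg (fun q => Ideal.span {q}) (dehomogenize_form_zero k).symm))
  · exact (congrArg (fun q => (Ideal.span {q}).radical) (dehomogenize_form_one k)).trans
      ((radical_span_g₁ k).trans (congrArg (fun q => Ideal.span {q}) (dehomogenize_form_one k).symm))
  · exact (congrArg (fun q => (Ideal.span {q}).radical) (dehomogenize_form_two k)).trans
      ((radical_span_g₂ k).trans (congrArg (fun q => Ideal.span {q}) (dehomogenize_form_two k).symm))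
  · exact (congrArg (fun q => (Ideal.span {q}).radical) (dehomogenize_form_three k)).trans
      ((radical_span_g₃ k).trans (congrArg (fun q => Ideal.span {q}) (dehomogenize_form_three k).symm))

/-- **The chart rings off the double line are regular**: `ChartRing F 2 ≅ k[y]/(g₂)` and `ChartRing F 3 ≅ k[y]/(g₃)`. [folklore] -/
theorem isRegularRing_chartRing_of_two_le (c : Fin 4) (hc : 2 ≤ (c : ℕ)) :
    IsRegularRing (ChartRing (CayleyRuled.form k) c (isHomogeneous_form k)) := by
  have hc' : c = 2 ∨ c = 3 := by
    fin_cases c <;> simp at hc ⊢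
  rcases hc' with rfl | rfl
  · obtain ⟨θ, -⟩ := HypersurfaceSpecimen.exists_chartQuotEquiv (CayleyRuled.form k) (isHomogeneous_form k) 2 (g₂ k)
      (dehomogenize_form_two k) (radical_span_g₂ k)
    haveI := isRegularRing_quotient_g₂ k
    exact IsRegularRing.of_ringEquiv θ.symm
  · obtain ⟨θ, -⟩ := HypersurfaceSpecimen.exists_chartQuotEquiv (CayleyRuled.form k) (isHomogeneous_form k) 3 (g₃ k)
      (dehomogenize_form_three k) (radical_span_g₃ k)
    haveI := isRegularRing_quotient_g₃ k
    exact IsRegularRing.of_ringEquiv θ.symm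

/-! ## The certificates, through the generic double-line files -/

/-- **Every blow-up of `H` along `𝓘⟨Σ⟩ · 𝒪_H` is regular** — ONE application of the generic double-line charts `DoubleLine.isRegular_of_isBlowup_comap_vanishingIdeal`
(p645742) to the polynomial data of `…NatSpecimenCayleyRuledAlgebra`. [folklore] -/
theorem isRegular_blowups :
    ∀ (Z : Scheme.{0}) (ρ : Z ⟶ (hypersurface (CayleyRuled.form k)).left),
      IsBlowup ρ ((vanishingIdeal (⟨_, WhitneyCubic.isClosed_doubleLine k⟩ :
        Closeds (Literature.AlgebraicGeometry.Motives.projectiveSpace 3 k).left)).comap (hypersurfaceι (CayleyRuled.form k)).left) →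
      Scheme.IsRegular Z :=
  DoubleLine.isRegular_of_isBlowup_comap_vanishingIdeal k (CayleyRuled.form k) (isHomogeneous_form k) three_pos
    (isRegularRing_chartRing_of_two_le k) (g₀ k) (g₁ k) (dehomogenize_form_zero k) (dehomogenize_form_one k)
    (radical_span_g₀ k) (radical_span_g₁ k) (isRegularRing_chart₀₁ k) (isRegularRing_chart₀₂ k) (isRegularRing_chart₁₁ k)
    (isRegularRing_chart₁₂ k)

/-- **THE B‴ NOSE PREDICATE HOLDS FOR CAYLEY'S RULED CUBIC** `H = V₊(x₀x₂² + x₁x₂x₃ + x₃³) ⊂ ℙ³_K` (ANY field `K`, every characteristic): by the double-line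
certificate schema `DoubleLine.reachNoseTowerBTriplePrime_of_isRegular_blowups` (p645692). Third kernel inhabitant of the chain's nose predicate.
[OURS · L1 W4.5b] -/
theorem reachNoseTowerBTriplePrime_cayleyRuled (K : Type) [Field K] :
    ReachNoseTowerBTriplePrime K 3 (hypersurface (CayleyRuled.form K)).left (hypersurfaceι (CayleyRuled.form K)).left :=
  DoubleLine.reachNoseTowerBTriplePrime_of_isRegular_blowups K (CayleyRuled.form K) (isHomogeneous_form K) (prime_form K)
    (form_mem_span K) (X_two_not_mem_span_form K) (isRegular_blowups K)

/-- **EL♮ FOR CAYLEY'S RULED CUBIC THROUGH THE REGISTERED RUNG** (`K` algebraically closed of characteristic `p`, ANY `p`): `ELNatAt p K 3 H ι`, by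
`DoubleLine.elNatAt_of_isRegular_blowups` (p645692: `stub_elnat_ciNoseThenPoints` p524326 + the locally-principal binder + `elNatAt_of_horizAt`).
[OURS · L1 W4.5b] -/
theorem elNatAt_cayleyRuled (p : ℕ) (hp : p.Prime) (K : Type) [Field K] [CharP K p] [IsAlgClosed K] :
    Theorems.EquisingularLift.ELNatAt p K 3 (hypersurface (CayleyRuled.form K)).left (hypersurfaceι (CayleyRuled.form K)).left :=
  DoubleLine.elNatAt_of_isRegular_blowups K p hp (CayleyRuled.form K) (isHomogeneous_form K) three_pos (prime_form K)
    (form_mem_span K) (X_two_not_mem_span_form K) (radical_dehomogenize K) (isRegular_blowups K)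

end CayleyRuled

end Summit.ResolutionOfSingularities.ResolutionOfSingularities.Cruxes.EquisingularLiftNat.Sections

end
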